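import Literature.NumberTheory.ComplexMultiplication.EllipticUnits.GrossencharacterReciprocity
import Literature.NumberTheory.LFunctions.AbelianFrobeniusDensity
import HarnessLib

/-!
# de Shalit II.4.4 (25) / II.4.9 (ii): the INVERSE Frobenius `σ_𝔭⁻¹` on division-point coordinates is multiplication by an inverse
# of `ψ(𝔭)` modulo the level — `ι̂(σ_𝔭⁻ⁿ x(ξ z)) = x(ξ(βⁿ z))`, `βψ(𝔭) ≡ 1 (mod 𝔠)` (proofs only, from the clauses (vi)(vii) of II.1.5)

Topic `NumberTheory/ComplexMultiplication/EllipticUnits` (theorems only; no definition, no named fact, no instance).  Cell `bsd-print-cf2`,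
width seat `bsd-line-cf2c-w4` g15, piece (α) of the `j = 0` seam: the levelwise base point of the Frobenius-twisted theta `t`-expansion
`φ^{-(m+1)}Q` is `τ^{m+1}ξ(Ω)` with `τ = σ_𝔭⁻¹` (de Shalit II §4.9 (ii): «`(φ⁻ⁿP)(z) = Θ(Λ(𝔭⁻ⁿ)w_n − z; …)`», (25):
`φⁿ(ξ(Λ(𝔭⁻ⁿ)w_n)) = ξ(Ω)`).  With the reciprocity law II.1.5 in the form of the tree's named fact
`DeShalit1987.prop15_grossencharacterReciprocity` — whose clauses (vi) (coordinates of `𝔠`-division points lie in `ι̂ K(𝔣𝔠)`) and (vii)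
(`ι̂(σ_𝔞 x) = ℘(ι(ψ𝔞)·z)`) are taken here as HYPOTHESES about given `𝔣`, `ψ` (the consumer obtains them once from the fact) — this file
computes the inverse orbit:

* `mul_mem_idealInvLattice`, `mul_notMem_of_mul_sub_one_mem` — `βz ∈ 𝔠⁻¹Λ ∖ Λ` for `z ∈ 𝔠⁻¹Λ ∖ Λ` and `β` a unit mod `𝔠`;
  `weierstrassP_mul_mul_eq_of_sub_one_mem` — `℘(ι(ψ𝔭)·ι(β)·z) = ℘(z)` for `βψ(𝔭) − 1 ∈ 𝔠` (`(βψ(𝔭) − 1)z ∈ Λ`);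
* ★ `algClosureEmb_galFrob_symm_eq` — **`ι̂(σ_v⁻¹ x) = ℘(ι β · z)` and `ι̂(σ_v⁻¹ y) = ℘′(ι β · z)`** for `ι̂ x = ℘ z`, `ι̂ y = ℘′ z`,
  `z ∈ 𝔠⁻¹Λ ∖ Λ`, `v ∤ 𝔣𝔠`, `βψ(v) ≡ 1 (mod 𝔠)` (`σ_v = galFrob K K(𝔣𝔠) v = artinSymbol … v`, `artinSymbol_asIdeal`);
* ★★ `algClosureEmb_galFrob_symm_iterate_eq` — the iterate: **`ι̂((σ_v⁻¹)^[n] x) = ℘(ι βⁿ · z)`**, `ι̂((σ_v⁻¹)^[n] y) = ℘′(ι βⁿ · z)` —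
  de Shalit's `w_n = βⁿΩ` (mod `L`): `π^n w_n ≡ Ω`; combined with `FrobeniusTwistReading.absGaloisRestrict_inv_pow_smul_coe_rayClassField`
  (`(res σ₀)⁻¹^n • y = (σ_v⁻¹)^[n] y`) this is the base point `τⁿP₀` of the cell's bridge (`relColemanSeries_eq_subst_subst_of_semiconj`).

No summit statement is proved; BSD is not proved by any of this.

## References
* [deShalit1987] E. de Shalit, *Iwasawa theory of elliptic curves with complex multiplication* (1987), II §1.5 (15) (18) (21), II §4.4 (25),
  II §4.9 Proposition (ii) (proof, p. 63).
* [Shimura1971] G. Shimura, *Introduction to the Arithmetic Theory of Automorphic Functions* (1971), Thm. 5.3, Prop. 7.40.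
-/

noncomputable section

open _root_.NumberField _root_.IsDedekindDomain PeriodPair

namespace Literature.NumberTheory.ComplexMultiplication.EllipticUnits

open Literature.NumberTheory.NumberFields (rayClassField)
open Literature.NumberTheory.GaloisRepresentations (galFrob)
open Literature.NumberTheory.LFunctions.AbelianDensity (artinSymbol artinSymbol_asIdeal)

variable {K : Type} [Field K] (ι : K →+* ℂ) {L : PeriodPair}

/-! ## §1 Lattice bookkeeping: `βz ∈ 𝔠⁻¹Λ ∖ Λ`, `℘(ψ(𝔭)βz) = ℘(z)` -/

/-- `𝔠⁻¹Λ` is an `𝒪_K`-module: `βz ∈ 𝔠⁻¹Λ` for `z ∈ 𝔠⁻¹Λ` (`Λ` with `𝒪_K`-multiplication). [cite: deShalit1987, II §1.3] -/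
theorem mul_mem_idealInvLattice (hΛ : IsCMLattice ι L.lattice) {𝔠 : Ideal (𝓞 K)} (β : 𝓞 K) {z : ℂ}
    (hz : z ∈ idealInvLattice ι 𝔠 L.lattice) : ι (β : K) * z ∈ idealInvLattice ι 𝔠 L.lattice := by
  refine mem_idealInvLattice_iff.mpr fun a ha => ?_
  rw [← mul_assoc, mul_comm (ι (a : K)), mul_assoc]
  exact hΛ β _ (mem_idealInvLattice_iff.mp hz a ha)

/-- If `βγ − 1 ∈ 𝔠` and `z ∈ 𝔠⁻¹Λ ∖ Λ` then `βz ∉ Λ` (`z = γβz − (βγ − 1)z`). [cite: deShalit1987, II §1.3] -/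
theorem mul_notMem_of_mul_sub_one_mem (hΛ : IsCMLattice ι L.lattice) {𝔠 : Ideal (𝓞 K)} {β γ : 𝓞 K} (hβ : β * γ - 1 ∈ 𝔠)
    {z : ℂ} (hz : z ∈ idealInvLattice ι 𝔠 L.lattice) (hz' : z ∉ L.lattice) : ι (β : K) * z ∉ L.lattice := by
  intro h
  apply hz'
  have h1 : ι (γ : K) * (ι (β : K) * z) ∈ L.lattice := hΛ γ _ h
  have h2 : ι ((β * γ - 1 : 𝓞 K) : K) * z ∈ L.lattice := mem_idealInvLattice_iff.mp hz _ hβ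
  have e : z = ι (γ : K) * (ι (β : K) * z) - ι ((β * γ - 1 : 𝓞 K) : K) * z := by push_cast; rw [map_sub, map_mul, map_one]; ring
  rw [e]
  exact L.lattice.sub_mem h1 h2

/-- `(βγ − 1)z ∈ Λ` as a lattice element: `ι(γ)·(ι(β)·z) = z + ℓ`. [cite: deShalit1987, II §1.3] -/
theorem exists_mul_mul_eq_add {𝔠 : Ideal (𝓞 K)} {β γ : 𝓞 K} (hβ : β * γ - 1 ∈ 𝔠)
    {z : ℂ} (hz : z ∈ idealInvLattice ι 𝔠 L.lattice) :
    ∃ l : L.lattice, ι (γ : K) * (ι (β : K) * z) = z + l := by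
  refine ⟨⟨ι ((β * γ - 1 : 𝓞 K) : K) * z, mem_idealInvLattice_iff.mp hz _ hβ⟩, ?_⟩
  push_cast
  rw [map_sub, map_mul, map_one]
  ring

/-- **`℘(ι γ · ι β · z) = ℘(z)`, `℘′(ι γ · ι β · z) = ℘′(z)`** for `βγ − 1 ∈ 𝔠`, `z ∈ 𝔠⁻¹Λ` (periodicity).
[cite: deShalit1987, II §1.5 (18)] -/
theorem weierstrassP_mul_mul_eq_of_sub_one_mem {𝔠 : Ideal (𝓞 K)} {β γ : 𝓞 K}
    (hβ : β * γ - 1 ∈ 𝔠) {z : ℂ} (hz : z ∈ idealInvLattice ι 𝔠 L.lattice) :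
    ℘[L] (ι (γ : K) * (ι (β : K) * z)) = ℘[L] z ∧ ℘'[L] (ι (γ : K) * (ι (β : K) * z)) = ℘'[L] z := by
  obtain ⟨l, hl⟩ := exists_mul_mul_eq_add ι hβ hz
  rw [hl, L.weierstrassP_add_coe, L.derivWeierstrassP_add_coe]
  exact ⟨rfl, rfl⟩

/-! ## §2 `σ_v⁻¹` on the coordinates of `𝔠`-division points -/

variable [NumberField K] {𝔣 𝔠 : Ideal (𝓞 K)} {ψ : Ideal (𝓞 K) → 𝓞 K} {v : HeightOneSpectrum (𝓞 K)}

/-- ★ **`ι̂(σ_v⁻¹ x) = ℘(ι β · z)`, `ι̂(σ_v⁻¹ y) = ℘′(ι β · z)`** (de Shalit II.4.4 (25), one step).  Hypotheses: `Λ` has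
`𝒪_K`-multiplication; clause (vi) of II.1.5 for `(𝔣, 𝔠)` (existence of coordinates in `K(𝔣𝔠)`) and clause (vii) at `𝔞 = v`
(`ι̂(σ_v x) = ℘(ι(ψ v)·z)`, `σ_v = artinSymbol (galFrob K K(𝔣𝔠)) v`); `z ∈ 𝔠⁻¹Λ ∖ Λ`; `β ψ(v) − 1 ∈ 𝔠`; `ι̂ x = ℘ z`, `ι̂ y = ℘′ z`.
Proof: the coordinates `x', y'` of `ξ(βz)` satisfy `σ_v x' = x`, `σ_v y' = y` by (vii) and periodicity, and `ι̂` is injective.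
[cite: deShalit1987, II §1.5 (15) (18), II §4.4 (25)] [cite: Shimura1971, Thm. 5.3] -/
theorem algClosureEmb_galFrob_symm_eq (hΛ : IsCMLattice ι L.lattice)
    (hvi : ∀ z : ℂ, z ∈ idealInvLattice ι 𝔠 L.lattice → z ∉ L.lattice →
      ∃ x y : rayClassField K (𝔣 * 𝔠), algClosureEmb ι x = ℘[L] z ∧ algClosureEmb ι y = ℘'[L] z)
    (hvii : ∀ z : ℂ, z ∈ idealInvLattice ι 𝔠 L.lattice → z ∉ L.lattice → ∀ x y : rayClassField K (𝔣 * 𝔠),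
      algClosureEmb ι x = ℘[L] z → algClosureEmb ι y = ℘'[L] z →
        algClosureEmb ι (artinSymbol (galFrob K (rayClassField K (𝔣 * 𝔠))) v.asIdeal x) = ℘[L] (ι (ψ v.asIdeal : K) * z) ∧
        algClosureEmb ι (artinSymbol (galFrob K (rayClassField K (𝔣 * 𝔠))) v.asIdeal y) = ℘'[L] (ι (ψ v.asIdeal : K) * z))
    {β : 𝓞 K} (hβ : β * ψ v.asIdeal - 1 ∈ 𝔠) {z : ℂ} (hz : z ∈ idealInvLattice ι 𝔠 L.lattice) (hz' : z ∉ L.lattice)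
    {x y : rayClassField K (𝔣 * 𝔠)} (hx : algClosureEmb ι x = ℘[L] z) (hy : algClosureEmb ι y = ℘'[L] z) :
    algClosureEmb ι ((galFrob K (rayClassField K (𝔣 * 𝔠)) v).symm x) = ℘[L] (ι (β : K) * z) ∧
      algClosureEmb ι ((galFrob K (rayClassField K (𝔣 * 𝔠)) v).symm y) = ℘'[L] (ι (β : K) * z) := by
  have hβz := mul_mem_idealInvLattice ι hΛ β hz
  have hβz' := mul_notMem_of_mul_sub_one_mem ι hΛ hβ hz hz'
  obtain ⟨x', y', hx', hy'⟩ := hvi _ hβz hβz'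
  obtain ⟨h1, h2⟩ := hvii _ hβz hβz' x' y' hx' hy'
  obtain ⟨hP, hP'⟩ := weierstrassP_mul_mul_eq_of_sub_one_mem ι hβ hz
  rw [artinSymbol_asIdeal, hP, ← hx] at h1
  rw [artinSymbol_asIdeal, hP', ← hy] at h2
  have e1 : galFrob K (rayClassField K (𝔣 * 𝔠)) v x' = x := Subtype.ext ((algClosureEmb ι).injective h1)
  have e2 : galFrob K (rayClassField K (𝔣 * 𝔠)) v y' = y := Subtype.ext ((algClosureEmb ι).injective h2)
  rw [← e1, ← e2, AlgEquiv.symm_apply_apply, AlgEquiv.symm_apply_apply]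
  exact ⟨hx', hy'⟩

/-- ★★ **The iterate: `ι̂((σ_v⁻¹)^[n] x) = ℘(ι βⁿ · z)`, `ι̂((σ_v⁻¹)^[n] y) = ℘′(ι βⁿ · z)`** — de Shalit's `w_n`: the `𝔣`-division point
with `φⁿ(ξ(w_n)) = ξ(Ω)` is `βⁿΩ` modulo `Λ`, `β` an inverse of `ψ(𝔭)` modulo `𝔣`.  With
`FrobeniusTwistReading.absGaloisRestrict_inv_pow_smul_coe_rayClassField` this describes `τⁿ(x(ξ z), y(ξ z))` for `τ = (res σ₀)⁻¹`, the base
point of `φ⁻ⁿQ` in the cell's bridge. [cite: deShalit1987, II §4.4 (25), II §4.9 Proposition (ii) (proof)] -/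
theorem algClosureEmb_galFrob_symm_iterate_eq (hΛ : IsCMLattice ι L.lattice)
    (hvi : ∀ z : ℂ, z ∈ idealInvLattice ι 𝔠 L.lattice → z ∉ L.lattice →
      ∃ x y : rayClassField K (𝔣 * 𝔠), algClosureEmb ι x = ℘[L] z ∧ algClosureEmb ι y = ℘'[L] z)
    (hvii : ∀ z : ℂ, z ∈ idealInvLattice ι 𝔠 L.lattice → z ∉ L.lattice → ∀ x y : rayClassField K (𝔣 * 𝔠),
      algClosureEmb ι x = ℘[L] z → algClosureEmb ι y = ℘'[L] z →
        algClosureEmb ι (artinSymbol (galFrob K (rayClassField K (𝔣 * 𝔠))) v.asIdeal x) = ℘[L] (ι (ψ v.asIdeal : K) * z) ∧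
        algClosureEmb ι (artinSymbol (galFrob K (rayClassField K (𝔣 * 𝔠))) v.asIdeal y) = ℘'[L] (ι (ψ v.asIdeal : K) * z))
    {β : 𝓞 K} (hβ : β * ψ v.asIdeal - 1 ∈ 𝔠) (n : ℕ) {z : ℂ} (hz : z ∈ idealInvLattice ι 𝔠 L.lattice) (hz' : z ∉ L.lattice)
    {x y : rayClassField K (𝔣 * 𝔠)} (hx : algClosureEmb ι x = ℘[L] z) (hy : algClosureEmb ι y = ℘'[L] z) :
    algClosureEmb ι ((fun w ↦ (galFrob K (rayClassField K (𝔣 * 𝔠)) v).symm w)^[n] x) = ℘[L] (ι ((β ^ n : 𝓞 K) : K) * z) ∧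
      algClosureEmb ι ((fun w ↦ (galFrob K (rayClassField K (𝔣 * 𝔠)) v).symm w)^[n] y) = ℘'[L] (ι ((β ^ n : 𝓞 K) : K) * z) := by
  induction n generalizing z x y with
  | zero =>
    rw [Function.iterate_zero_apply, Function.iterate_zero_apply, pow_zero]
    push_cast
    rw [map_one, one_mul]
    exact ⟨hx, hy⟩
  | succ n ih =>
    obtain ⟨h1, h2⟩ := algClosureEmb_galFrob_symm_eq ι hΛ hvi hvii hβ hz hz' hx hy
    obtain ⟨h3, h4⟩ := ih (mul_mem_idealInvLattice ι hΛ β hz) (mul_notMem_of_mul_sub_one_mem ι hΛ hβ hz hz') h1 h2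
    have e : ι ((β ^ (n + 1) : 𝓞 K) : K) * z = ι ((β ^ n : 𝓞 K) : K) * (ι (β : K) * z) := by
      push_cast
      rw [map_pow, map_pow]
      ring
    rw [Function.iterate_succ_apply, Function.iterate_succ_apply, h3, h4, e]
    exact ⟨rfl, rfl⟩

/-! ## §3 Appended (g15): MODEL coordinates `x = ℘ − b`, `y = (℘′ − a₁x − a₃)/2` through a data ring with `τ` reading `σ_v⁻¹` -/

/-- ★★ **The `τ`-orbit of the base point in model coordinates.**  In the setting of `algClosureEmb_galFrob_symm_iterate_eq`, let `R` be any
type with maps `τ : R → R`, `j_F : R → K(𝔣𝔠)` such that `j_F (τ r) = σ_v⁻¹ (j_F r)` (e.g. `DeShalit1987.readingRing` with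
`(readingFrob …).symm`, `coe_readingFrob_symm`), and let `x₀, y₀ ∈ R` read the MODEL coordinates of `ξ(z)`:
`ι̂ j_F x₀ = ℘(z) − ι b`, `ι̂ j_F y₀ = (℘′(z) − ι a₁·(℘(z) − ι b) − ι a₃)/2` (`b, a₁, a₃ ∈ K`, e.g. `b₂/12, a₁, a₃` of a `K`-model).  Then for
every `n`: **`ι̂ j_F (τⁿ x₀) = ℘(ι βⁿ·z) − ι b`** and **`ι̂ j_F (τⁿ y₀) = (℘′(ι βⁿ·z) − ι a₁(℘(ι βⁿ·z) − ι b) − ι a₃)/2`** — the hypotheses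
`hτx₀`/`hτy₀` of `KatzMeasureJZeroSeam.exists_unit_relColemanSeries_eq_subst_subst_of_thetaReadings` (there `j = (↑) ∘ j_F`).
[cite: deShalit1987, II §4.4 (25), II §4.9 Proposition (ii) (proof)] -/
theorem algClosureEmb_iterate_model_eq (hΛ : IsCMLattice ι L.lattice)
    (hvi : ∀ z : ℂ, z ∈ idealInvLattice ι 𝔠 L.lattice → z ∉ L.lattice →
      ∃ x y : rayClassField K (𝔣 * 𝔠), algClosureEmb ι x = ℘[L] z ∧ algClosureEmb ι y = ℘'[L] z)
    (hvii : ∀ z : ℂ, z ∈ idealInvLattice ι 𝔠 L.lattice → z ∉ L.lattice → ∀ x y : rayClassField K (𝔣 * 𝔠),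
      algClosureEmb ι x = ℘[L] z → algClosureEmb ι y = ℘'[L] z →
        algClosureEmb ι (artinSymbol (galFrob K (rayClassField K (𝔣 * 𝔠))) v.asIdeal x) = ℘[L] (ι (ψ v.asIdeal : K) * z) ∧
        algClosureEmb ι (artinSymbol (galFrob K (rayClassField K (𝔣 * 𝔠))) v.asIdeal y) = ℘'[L] (ι (ψ v.asIdeal : K) * z))
    {β : 𝓞 K} (hβ : β * ψ v.asIdeal - 1 ∈ 𝔠) {z : ℂ} (hz : z ∈ idealInvLattice ι 𝔠 L.lattice) (hz' : z ∉ L.lattice)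
    {R : Type*} (τ : R → R) (jF : R → rayClassField K (𝔣 * 𝔠))
    (hjτ : ∀ r : R, jF (τ r) = (galFrob K (rayClassField K (𝔣 * 𝔠)) v).symm (jF r)) (b a₁ a₃ : K) {x₀ y₀ : R}
    (hx₀ : algClosureEmb ι (jF x₀) = ℘[L] z - ι b)
    (hy₀ : algClosureEmb ι (jF y₀) = (℘'[L] z - ι a₁ * (℘[L] z - ι b) - ι a₃) / 2) (n : ℕ) :
    algClosureEmb ι (jF (τ^[n] x₀)) = ℘[L] (ι ((β ^ n : 𝓞 K) : K) * z) - ι b ∧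
      algClosureEmb ι (jF (τ^[n] y₀)) =
        (℘'[L] (ι ((β ^ n : 𝓞 K) : K) * z) - ι a₁ * (℘[L] (ι ((β ^ n : 𝓞 K) : K) * z) - ι b) - ι a₃) / 2 := by
  -- read everything through the ring map `Φ = ι̂ ∘ (K(𝔣𝔠) ⊂ K̄)`
  let Φ : rayClassField K (𝔣 * 𝔠) →+* ℂ :=
    (algClosureEmb ι).comp ((rayClassField K (𝔣 * 𝔠)).val : rayClassField K (𝔣 * 𝔠) →ₐ[K] AlgebraicClosure K).toRingHom
  have hΦ : ∀ w : rayClassField K (𝔣 * 𝔠), algClosureEmb ι (w : AlgebraicClosure K) = Φ w := fun _ => rfl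
  have hK : ∀ c : K, Φ (algebraMap K (rayClassField K (𝔣 * 𝔠)) c) = ι c := fun c => by
    change algClosureEmb ι ((rayClassField K (𝔣 * 𝔠)).val (algebraMap K (rayClassField K (𝔣 * 𝔠)) c)) = ι c
    rw [AlgHom.commutes, algClosureEmb_algebraMap]
  rw [hΦ] at hx₀ hy₀
  -- the `℘`-coordinates `x̃ = j x₀ + b`, `ỹ = 2 j y₀ + a₁ j x₀ + a₃` in `K(𝔣𝔠)`
  have hx : algClosureEmb ι (jF x₀ + algebraMap K _ b : rayClassField K (𝔣 * 𝔠)) = ℘[L] z := by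
    rw [hΦ, map_add, hx₀, hK]; ring
  have hy : algClosureEmb ι (2 * jF y₀ + algebraMap K _ a₁ * jF x₀ + algebraMap K _ a₃ : rayClassField K (𝔣 * 𝔠)) = ℘'[L] z := by
    rw [hΦ]
    simp only [map_add, map_mul, map_ofNat, hK, hx₀, hy₀]
    ring
  obtain ⟨h1, h2⟩ := algClosureEmb_galFrob_symm_iterate_eq ι hΛ hvi hvii hβ n hz hz' hx hy
  -- `σ_v⁻ⁿ` of these is `j(τⁿ x₀) + b`, `2 j(τⁿ y₀) + a₁ j(τⁿ x₀) + a₃`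
  have hit : ∀ k : ℕ,
      (fun w ↦ (galFrob K (rayClassField K (𝔣 * 𝔠)) v).symm w)^[k] (jF x₀ + algebraMap K _ b) = jF (τ^[k] x₀) + algebraMap K _ b ∧
      (fun w ↦ (galFrob K (rayClassField K (𝔣 * 𝔠)) v).symm w)^[k] (2 * jF y₀ + algebraMap K _ a₁ * jF x₀ + algebraMap K _ a₃) =
        2 * jF (τ^[k] y₀) + algebraMap K _ a₁ * jF (τ^[k] x₀) + algebraMap K _ a₃ := by
    intro k
    induction k with
    | zero => exact ⟨rfl, rfl⟩
    | succ k ih =>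
      rw [Function.iterate_succ_apply', Function.iterate_succ_apply', Function.iterate_succ_apply', Function.iterate_succ_apply', ih.1,
        ih.2]
      refine ⟨?_, ?_⟩
      · rw [map_add, AlgEquiv.commutes, hjτ]
      · rw [map_add, map_add, map_mul, map_mul, map_ofNat, AlgEquiv.commutes, AlgEquiv.commutes, hjτ, hjτ]
  rw [(hit n).1, hΦ, map_add, hK] at h1
  rw [(hit n).2, hΦ] at h2
  simp only [map_add, map_mul, map_ofNat, hK] at h2
  rw [hΦ, hΦ]
  have ex : Φ (jF (τ^[n] x₀)) = ℘[L] (ι ((β ^ n : 𝓞 K) : K) * z) - ι b := by rw [← h1]; ring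
  refine ⟨ex, ?_⟩
  rw [ex] at h2
  linear_combination (1 / 2 : ℂ) * h2

end Literature.NumberTheory.ComplexMultiplication.EllipticUnits

end
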